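import Summits.Ventures.HSemireg.WedgeHankelSubstitutionSemisimpleEigenspaces

/-!
# Venture HSemireg — THE CENTRALIZER OF A SEMISIMPLE SUBSTITUTION ON TH-7's CLASSES: an endomorphism commutes with a diagonalisable `T` iff it maps every eigen-class into
# the eigenspace of its weight, so `dim Centralizer(T) = Σ_i dim eigenspace(μ_i) = Σ_m (multiplicity of m)²`; for th-7's torus with distinct powers and every substitution with
# `n + 1` distinct weights this is `n + 1` (the diagonal algebra), for the split trace-zero substitutions (`SbC(t 0 0 −t)`, the swap, the quarter turn with `√−1`) it is
# `(⌊n/2⌋ + 1)² + ⌈n/2⌉²`, and for a scalar `(n + 1)²`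

HONEST FRAMING. Part of the Lean index of the computation cell `pub-hsemireg` (seat p10 gen 22, Sunday typer «UNIFORM-IN-n»).
Finite-dimensional EXTERIOR ALGEBRA + linear algebra ONLY: no variety, no cohomology theory, no sheaf, no Ext group, no semiregularity map;
nothing here says that HC / HC_CM / HC_AV holds; no Literature fact is declared or used.  Custodian versions as in `WedgeHankelSiegelIdeal` (1/3) and `WedgeHankelFrameChange`;
the dictionary (the commutant of a semisimple element of `GL₂` acting on `Sym^n`) is QUOTED, never asserted.

WHAT IS IN THE TREE.  K18 (`WedgeHankelSubstitutionSemisimpleEigenspaces`): `eigenspace_eq_span_of_eigenbasis`, `finrank_eigenspace_of_eigenbasis` (`dim E_m = #{i : μ_i = m}`),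
`finrank_eigenspace_SbC_diag_neg_self` / `_neg`, `card_filter_even_fin` / `_odd_fin`, `card_filter_weight_neg_eq_self` / `_eq_neg`, `weight_eq_neg_of_trace_zero`; K9
`apply_spikeBasis_eq_smul_of_commute_torus` (commuting with the torus ⇒ diagonal, no dimension), K13 / K22 (the centralizer of the SHEAR: `n + 1` for `n!·λ ≠ 0`, the Jordan count
in characteristic `p`); J17 `exists_eigenbasis_SbC_of_fixed_two`, K3 `SbC_diag_spikeBasis`.  THIS FILE (namespace `Summit.Ventures.HSemireg.Wedge.HankelFrameChange` continued; imports
K18) types the centralizer of the SEMISIMPLE substitutions: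
* §319 GENERALITY (`T (b i) = μ_i • b i` for a basis `b`): **`commute_iff_apply_mem_eigenspace_of_eigenbasis`** (`φT = Tφ ⇔ φ(b i) ∈ E_{μ_i}` for all `i`),
  `exists_commute_of_targets_of_eigenbasis`, **`finrank_centralizer_of_eigenbasis`: `dim Subalgebra.centralizer {T} = Σ_i dim E_{μ_i}`**,
  **`finrank_centralizer_of_eigenbasis_eq_sum_card`** (`= Σ_i #{j : μ_j = μ_i}`), **`finrank_centralizer_of_eigenbasis_of_injective`** (distinct weights: `= #ι`, the diagonal algebra).
* §320 TH-7's CLASSES: **`finrank_centralizer_SbC_of_fixed_two`** (two distinct fixed nodes: `Σ_p #{p' : w_{p'} = w_p}`), **`finrank_centralizer_SbC_of_fixed_two_of_injective`** (`= n + 1`),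
  `finrank_centralizer_SbC_diag`, **`finrank_centralizer_SbC_torus`** (`SbC(1 0 0 t)`, `t^0, …, t^n` distinct: `n + 1`), `finrank_centralizer_SbC_scalar` (`SbC(t 0 0 t)`: `(n+1)²`).
* §321 SPLIT TRACE-ZERO (`2 ≠ 0`): `sum_card_filter_weight_neg_eq`, **`finrank_centralizer_SbC_diag_neg`** (`SbC(t 0 0 −t)`, `t ≠ 0`: `(n/2 + 1)² + ((n+1)/2)²`),
  **`finrank_centralizer_SbC_trace_zero`** (`g = (α β; γ −α)` with two distinct fixed nodes in `K`, `s ≠ 0`), `finrank_centralizer_SbC_swap` (`(n/2+1)² + ((n+1)/2)²`),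
  `finrank_centralizer_SbC_quarter_of_sq_eq_neg_one`.
NOT typed here: non-split semisimple substitutions (centralizer over `K` of an elliptic `g`); the joint commutant of two substitutions (J13/K9: scalars); anything Ext-side.
New names only.
-/

open Module

namespace Summit.Ventures.HSemireg.Wedge.HankelFrameChange

open Summit.Ventures.HSemireg.Wedge Summit.Ventures.HSemireg.Wedge.Kunneth Summit.Ventures.HSemireg.Wedge.Hankel
  Summit.Ventures.HSemireg.Wedge.BasisFree Summit.Ventures.HSemireg.Wedge.HankelSiegel Summit.Ventures.HSemireg.Wedge.HankelSiegelIdeal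
  Summit.Ventures.HSemireg.Wedge.KunnethKernel Summit.Ventures.HSemireg.Wedge.HankelRankOne Summit.Ventures.HSemireg.Wedge.KernelDuality

variable (K : Type*) [Field K] {n : ℕ}

/-! ## §319. Generality: the centralizer of an endomorphism with an eigenbasis -/

section EigenbasisCentralizer

variable {V : Type*} [AddCommGroup V] [Module K V] {ι : Type*} [Fintype ι]

omit [Fintype ι] in
/-- **`φ` commutes with `T` iff `φ` maps every eigenbasis vector `b i` into the eigenspace of its weight `μ_i`** (every field). -/
theorem commute_iff_apply_mem_eigenspace_of_eigenbasis (T : V →ₗ[K] V) (b : Basis ι K V) (μ : ι → K) (hb : ∀ i, T (b i) = μ i • b i) (φ : V →ₗ[K] V) :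
    φ * T = T * φ ↔ ∀ i, φ (b i) ∈ Module.End.eigenspace T (μ i) := by
  constructor
  · intro h i
    rw [Module.End.mem_eigenspace_iff, ← Module.End.mul_apply, ← h, Module.End.mul_apply, hb, map_smul]
  · intro h
    refine b.ext fun i => ?_
    rw [Module.End.mul_apply, Module.End.mul_apply, hb, map_smul, Module.End.mem_eigenspace_iff.mp (h i)]

omit [Fintype ι] in
/-- existence: targets `v_i ∈ E_{μ_i}` are the values on `b` of an endomorphism commuting with `T` (`φ := b.constr v`). -/
theorem exists_commute_of_targets_of_eigenbasis (T : V →ₗ[K] V) (b : Basis ι K V) (μ : ι → K) (hb : ∀ i, T (b i) = μ i • b i) (v : ι → V)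
    (hv : ∀ i, v i ∈ Module.End.eigenspace T (μ i)) : ∃ φ : V →ₗ[K] V, φ * T = T * φ ∧ ∀ i, φ (b i) = v i := by
  classical
  refine ⟨b.constr K v, (commute_iff_apply_mem_eigenspace_of_eigenbasis K T b μ hb _).mpr fun i => ?_, fun i => Basis.constr_basis b K v i⟩
  rw [Basis.constr_basis]; exact hv i

/-- **THE DIMENSION OF THE CENTRALIZER OF A DIAGONALISABLE ENDOMORPHISM: `dim Subalgebra.centralizer {T} = Σ_i dim eigenspace(T, μ_i)`** — evaluation on the eigenbasis is a linear
bijection from the centralizer onto `Π_i E_{μ_i}` (finite-dimensional `V`, every field). -/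
theorem finrank_centralizer_of_eigenbasis [FiniteDimensional K V] (T : V →ₗ[K] V) (b : Basis ι K V) (μ : ι → K) (hb : ∀ i, T (b i) = μ i • b i) :
    finrank K ↥(Subalgebra.centralizer K ({T} : Set (Module.End K V))) = ∑ i, finrank K ↥(Module.End.eigenspace T (μ i)) := by
  classical
  let C := Subalgebra.toSubmodule (Subalgebra.centralizer K ({T} : Set (Module.End K V)))
  have hC : ∀ φ : Module.End K V, φ ∈ C ↔ φ * T = T * φ := fun φ => by
    rw [Subalgebra.mem_toSubmodule, Subalgebra.mem_centralizer_iff]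
    simp only [Set.mem_singleton_iff, forall_eq]
    exact eq_comm
  -- evaluation on the eigenbasis, with values in the product of the eigenspaces
  have hmem : ∀ (x : ↥C) (i : ι), (x : Module.End K V) (b i) ∈ Module.End.eigenspace T (μ i) := fun x =>
    (commute_iff_apply_mem_eigenspace_of_eigenbasis K T b μ hb _).mp ((hC _).mp x.2)
  let ev : ↥C →ₗ[K] ((i : ι) → ↥(Module.End.eigenspace T (μ i))) :=
    LinearMap.pi fun i => LinearMap.codRestrict (Module.End.eigenspace T (μ i)) ((LinearMap.applyₗ (b i)).comp C.subtype) fun x => hmem x i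
  have hev : ∀ (x : ↥C) (i : ι), (ev x i : V) = (x : Module.End K V) (b i) := fun x i => rfl
  have hbij : Function.Bijective ev := by
    refine ⟨fun x y hxy => Subtype.ext (b.ext fun i => ?_), fun v => ?_⟩
    · rw [← hev, ← hev, hxy]
    · obtain ⟨φ, hφ, hφv⟩ := exists_commute_of_targets_of_eigenbasis K T b μ hb (fun i => (v i : V)) fun i => (v i).2
      exact ⟨⟨φ, (hC φ).mpr hφ⟩, funext fun i => Subtype.ext (by rw [hev]; exact hφv i)⟩
  rw [← Subalgebra.finrank_toSubmodule, (LinearEquiv.ofBijective ev hbij).finrank_eq, Module.finrank_pi_fintype]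

/-- **… `= Σ_i #{j : μ_j = μ_i}` = Σ over the distinct weights of (multiplicity)²** (K18's count of each eigenspace). -/
theorem finrank_centralizer_of_eigenbasis_eq_sum_card [FiniteDimensional K V] [DecidableEq K] (T : V →ₗ[K] V) (b : Basis ι K V) (μ : ι → K)
    (hb : ∀ i, T (b i) = μ i • b i) :
    finrank K ↥(Subalgebra.centralizer K ({T} : Set (Module.End K V))) = ∑ i, (Finset.univ.filter fun j => μ j = μ i).card := by
  rw [finrank_centralizer_of_eigenbasis K T b μ hb]
  exact Finset.sum_congr rfl fun i _ => finrank_eigenspace_of_eigenbasis K T b μ hb (μ i)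

/-- **DISTINCT WEIGHTS: the centralizer is the diagonal algebra, of dimension `#ι`.** -/
theorem finrank_centralizer_of_eigenbasis_of_injective [FiniteDimensional K V] (T : V →ₗ[K] V) (b : Basis ι K V) (μ : ι → K) (hb : ∀ i, T (b i) = μ i • b i)
    (hμ : Function.Injective μ) : finrank K ↥(Subalgebra.centralizer K ({T} : Set (Module.End K V))) = Fintype.card ι := by
  classical
  rw [finrank_centralizer_of_eigenbasis_eq_sum_card K T b μ hb, ← Finset.card_univ, Finset.card_eq_sum_ones Finset.univ]
  refine Finset.sum_congr rfl fun i _ => ?_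
  rw [Finset.card_eq_one]
  exact ⟨i, Finset.ext fun j => by rw [Finset.mem_filter, Finset.mem_singleton]; exact ⟨fun h => hμ h.2, fun h => ⟨Finset.mem_univ _, by rw [h]⟩⟩⟩

end EigenbasisCentralizer

/-! ## §320. The centralizer of a semisimple substitution on th-7's classes -/

open Classical in
/-- **TWO DISTINCT FIXED NODES `λ₁ ≠ λ₂` IN `K`: `dim Centralizer(SbC g) = Σ_p #{p' ≤ n : w_{p'} = w_p}`**, `w_p = (α+λ₁γ)^{n−p}(α+λ₂γ)^p` (J17's eigenbasis + §319). -/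
theorem finrank_centralizer_SbC_of_fixed_two {α β γ δ l₁ l₂ : K} (h₁₂ : l₁ ≠ l₂) (e₁ : β + l₁ * δ = l₁ * (α + l₁ * γ)) (e₂ : β + l₂ * δ = l₂ * (α + l₂ * γ)) :
    finrank K ↥(Subalgebra.centralizer K ({SbC K α β γ δ} : Set (Module.End K (spikeSpan K n)))) =
      ∑ p : Fin (n + 1), (Finset.univ.filter fun p' : Fin (n + 1) =>
        (α + l₁ * γ) ^ (n - (p' : ℕ)) * (α + l₂ * γ) ^ (p' : ℕ) = (α + l₁ * γ) ^ (n - (p : ℕ)) * (α + l₂ * γ) ^ (p : ℕ)).card := by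
  obtain ⟨b, hb⟩ := exists_eigenbasis_SbC_of_fixed_two K (n := n) h₁₂ e₁ e₂
  exact finrank_centralizer_of_eigenbasis_eq_sum_card K _ b _ hb

/-- **two distinct fixed nodes and `n + 1` DISTINCT WEIGHTS: `dim Centralizer(SbC g) = n + 1`** (the diagonal algebra in the eigenbasis; compare K13 for the shear). -/
theorem finrank_centralizer_SbC_of_fixed_two_of_injective {α β γ δ l₁ l₂ : K} (h₁₂ : l₁ ≠ l₂) (e₁ : β + l₁ * δ = l₁ * (α + l₁ * γ)) (e₂ : β + l₂ * δ = l₂ * (α + l₂ * γ))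
    (hμ : Function.Injective fun p : Fin (n + 1) => (α + l₁ * γ) ^ (n - (p : ℕ)) * (α + l₂ * γ) ^ (p : ℕ)) :
    finrank K ↥(Subalgebra.centralizer K ({SbC K α β γ δ} : Set (Module.End K (spikeSpan K n)))) = n + 1 := by
  obtain ⟨b, hb⟩ := exists_eigenbasis_SbC_of_fixed_two K (n := n) h₁₂ e₁ e₂
  rw [finrank_centralizer_of_eigenbasis_of_injective K _ b _ hb hμ, Fintype.card_fin]

open Classical in
/-- the diagonal torus `SbC(a 0 0 d)`: `dim Centralizer = Σ_p #{p' : a^{n−p'}d^{p'} = a^{n−p}d^p}` (th-7's own spikes are the eigenbasis). -/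
theorem finrank_centralizer_SbC_diag (a d : K) :
    finrank K ↥(Subalgebra.centralizer K ({SbC K a 0 0 d} : Set (Module.End K (spikeSpan K n)))) =
      ∑ p : Fin (n + 1), (Finset.univ.filter fun p' : Fin (n + 1) => a ^ (n - (p' : ℕ)) * d ^ (p' : ℕ) = a ^ (n - (p : ℕ)) * d ^ (p : ℕ)).card :=
  finrank_centralizer_of_eigenbasis_eq_sum_card K _ (spikeBasis K n) _ (SbC_diag_spikeBasis K a d)

/-- **TH-7's TORUS ELEMENT `SbC(1 0 0 t)` WITH `t^0, …, t^n` PAIRWISE DISTINCT: `dim Centralizer = n + 1`** — exactly the endomorphisms diagonal in th-7's spike basis (K9 gave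
«diagonal», this gives the count). -/
theorem finrank_centralizer_SbC_torus {t : K} (ht : Function.Injective fun q : Fin (n + 1) => t ^ (q : ℕ)) :
    finrank K ↥(Subalgebra.centralizer K ({SbC K 1 0 0 t} : Set (Module.End K (spikeSpan K n)))) = n + 1 := by
  have hμ : Function.Injective fun p : Fin (n + 1) => (1 : K) ^ (n - (p : ℕ)) * t ^ (p : ℕ) := fun p q h => ht (by simpa only [one_pow, one_mul] using h)
  rw [finrank_centralizer_of_eigenbasis_of_injective K _ (spikeBasis K n) _ (SbC_diag_spikeBasis K 1 t) hμ, Fintype.card_fin]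

open Classical in
/-- a scalar substitution `SbC(t 0 0 t)` commutes with everything: `dim Centralizer = (n + 1)²` (all `n + 1` weights equal `t^n`). -/
theorem finrank_centralizer_SbC_scalar (t : K) :
    finrank K ↥(Subalgebra.centralizer K ({SbC K t 0 0 t} : Set (Module.End K (spikeSpan K n)))) = (n + 1) * (n + 1) := by
  rw [finrank_centralizer_SbC_diag]
  have h : ∀ p : Fin (n + 1), (Finset.univ.filter fun p' : Fin (n + 1) => t ^ (n - (p' : ℕ)) * t ^ (p' : ℕ) = t ^ (n - (p : ℕ)) * t ^ (p : ℕ)) = Finset.univ :=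
    fun p => Finset.filter_true_of_mem fun p' _ => by rw [← pow_add, ← pow_add, Nat.sub_add_cancel (Nat.le_of_lt_succ p'.2), Nat.sub_add_cancel (Nat.le_of_lt_succ p.2)]
  simp only [h, Finset.card_univ, Fintype.card_fin, Finset.sum_const, smul_eq_mul]

/-! ## §321. Split trace-zero substitutions: `(⌊n/2⌋ + 1)² + ⌈n/2⌉²` -/

open Classical in
/-- the count for alternating weights `(−1)^p c^n` (`c ≠ 0`, `2 ≠ 0`): `Σ_p #{p' : w_{p'} = w_p} = (n/2 + 1)² + ((n+1)/2)²`. -/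
theorem sum_card_filter_weight_neg_eq (h2 : (2 : K) ≠ 0) {c : K} (hc : c ≠ 0) :
    ∑ p : Fin (n + 1), (Finset.univ.filter fun p' : Fin (n + 1) => c ^ (n - (p' : ℕ)) * (-c) ^ (p' : ℕ) = c ^ (n - (p : ℕ)) * (-c) ^ (p : ℕ)).card =
      (n / 2 + 1) * (n / 2 + 1) + (n + 1) / 2 * ((n + 1) / 2) := by
  rw [← Finset.sum_filter_add_sum_filter_not Finset.univ (fun p : Fin (n + 1) => Even (p : ℕ))]
  have hev : ∀ p ∈ Finset.univ.filter (fun p : Fin (n + 1) => Even (p : ℕ)),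
      (Finset.univ.filter fun p' : Fin (n + 1) => c ^ (n - (p' : ℕ)) * (-c) ^ (p' : ℕ) = c ^ (n - (p : ℕ)) * (-c) ^ (p : ℕ)).card = n / 2 + 1 := fun p hp => by
    rw [(Finset.mem_filter.mp hp).2 |> fun he => show c ^ (n - (p : ℕ)) * (-c) ^ (p : ℕ) = c ^ n by rw [pow_sub_mul_neg_pow, he.neg_one_pow, one_mul]]
    exact card_filter_weight_neg_eq_self K h2 hc
  have hod : ∀ p ∈ Finset.univ.filter (fun p : Fin (n + 1) => ¬ Even (p : ℕ)),
      (Finset.univ.filter fun p' : Fin (n + 1) => c ^ (n - (p' : ℕ)) * (-c) ^ (p' : ℕ) = c ^ (n - (p : ℕ)) * (-c) ^ (p : ℕ)).card = (n + 1) / 2 := fun p hp => by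
    rw [(Nat.not_even_iff_odd.mp (Finset.mem_filter.mp hp).2) |> fun ho => show c ^ (n - (p : ℕ)) * (-c) ^ (p : ℕ) = -c ^ n by rw [pow_sub_mul_neg_pow, ho.neg_one_pow, neg_one_mul]]
    exact card_filter_weight_neg_eq_neg K h2 hc
  rw [Finset.sum_congr rfl hev, Finset.sum_congr rfl hod, Finset.sum_const, Finset.sum_const, smul_eq_mul, smul_eq_mul, card_filter_even_fin]
  have e : (Finset.univ.filter fun p : Fin (n + 1) => ¬ Even (p : ℕ)) = Finset.univ.filter fun p : Fin (n + 1) => Odd (p : ℕ) :=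
    Finset.filter_congr fun p _ => Nat.not_even_iff_odd
  rw [e, card_filter_odd_fin]

/-- **THE NEGATIVE SCALINGS `SbC(t 0 0 −t)` (`t ≠ 0`, `2 ≠ 0`): `dim Centralizer = (n/2 + 1)² + ((n+1)/2)²`** (endomorphisms preserving the even and the odd spikes). -/
theorem finrank_centralizer_SbC_diag_neg (h2 : (2 : K) ≠ 0) {t : K} (ht : t ≠ 0) :
    finrank K ↥(Subalgebra.centralizer K ({SbC K t 0 0 (-t)} : Set (Module.End K (spikeSpan K n)))) = (n / 2 + 1) * (n / 2 + 1) + (n + 1) / 2 * ((n + 1) / 2) := by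
  classical
  rw [finrank_centralizer_SbC_diag, sum_card_filter_weight_neg_eq K h2 ht]

/-- **SPLIT TRACE-ZERO `g = (α β; γ −α)` with fixed nodes `λ₁ ≠ λ₂` in `K` and `s = α + λ₁γ ≠ 0` (`2 ≠ 0`): `dim Centralizer(SbC g) = (n/2 + 1)² + ((n+1)/2)²`.** -/
theorem finrank_centralizer_SbC_trace_zero (h2 : (2 : K) ≠ 0) {α β γ l₁ l₂ : K} (h₁₂ : l₁ ≠ l₂) (e₁ : β + l₁ * -α = l₁ * (α + l₁ * γ)) (e₂ : β + l₂ * -α = l₂ * (α + l₂ * γ))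
    (hs : α + l₁ * γ ≠ 0) :
    finrank K ↥(Subalgebra.centralizer K ({SbC K α β γ (-α)} : Set (Module.End K (spikeSpan K n)))) = (n / 2 + 1) * (n / 2 + 1) + (n + 1) / 2 * ((n + 1) / 2) := by
  classical
  rw [finrank_centralizer_SbC_of_fixed_two K h₁₂ e₁ e₂, weight_eq_neg_of_trace_zero K h₁₂ e₁ e₂]
  exact sum_card_filter_weight_neg_eq K h2 hs

/-- the swap `SbC(0 1 1 0)` (`2 ≠ 0`): `dim Centralizer = (n/2 + 1)² + ((n+1)/2)²` (endomorphisms preserving the palindromes and the anti-palindromes, K14). -/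
theorem finrank_centralizer_SbC_swap (h2 : (2 : K) ≠ 0) :
    finrank K ↥(Subalgebra.centralizer K ({SbC K 0 1 1 0} : Set (Module.End K (spikeSpan K n)))) = (n / 2 + 1) * (n / 2 + 1) + (n + 1) / 2 * ((n + 1) / 2) := by
  have h₁₂ : (1 : K) ≠ -1 := fun h => h2 (by rw [show (2 : K) = 1 - (-1) by ring, ← h, sub_self])
  have e₁ : (1 : K) + 1 * -0 = 1 * (0 + 1 * 1) := by ring
  have e₂ : (1 : K) + -1 * -0 = -1 * (0 + -1 * 1) := by ring
  have h := finrank_centralizer_SbC_trace_zero K (n := n) h2 h₁₂ e₁ e₂ (by norm_num)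
  rwa [neg_zero] at h

/-- the quarter turn over a field with `i² = −1` (`2 ≠ 0`): `dim Centralizer = (n/2 + 1)² + ((n+1)/2)²`. -/
theorem finrank_centralizer_SbC_quarter_of_sq_eq_neg_one (h2 : (2 : K) ≠ 0) {i : K} (hi : i ^ 2 = -1) :
    finrank K ↥(Subalgebra.centralizer K ({SbC K 0 (-1) 1 0} : Set (Module.End K (spikeSpan K n)))) = (n / 2 + 1) * (n / 2 + 1) + (n + 1) / 2 * ((n + 1) / 2) := by
  have hi0 : i ≠ 0 := fun h => by rw [h, sq, mul_zero] at hi; exact one_ne_zero (neg_eq_zero.mp hi.symm)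
  have h₁₂ : i ≠ -i := fun h => hi0 ((mul_eq_zero.mp (show (2 : K) * i = 0 by rw [two_mul, add_eq_zero_iff_eq_neg]; exact h)).resolve_left h2)
  have e₁ : (-1 : K) + i * -0 = i * (0 + i * 1) := by rw [neg_zero, mul_zero, add_zero, zero_add, mul_one, ← sq, hi]
  have e₂ : (-1 : K) + -i * -0 = -i * (0 + -i * 1) := by rw [neg_zero, mul_zero, add_zero, zero_add, mul_one, neg_mul_neg, ← sq, hi]
  have hs : (0 : K) + i * 1 ≠ 0 := by rwa [zero_add, mul_one]
  have h := finrank_centralizer_SbC_trace_zero K (n := n) h2 h₁₂ e₁ e₂ hs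
  rwa [neg_zero] at h

end Summit.Ventures.HSemireg.Wedge.HankelFrameChange
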